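import Summits.BirchSwinnertonDyer.BirchSwinnertonDyer.Theses.TameQuarticManinParity
import HarnessLib

/-!
# Route `TameQuarticManinParity`, LINE 20 (bsd-idea-3 g7), glue G20 `TprimeRedKodairaThreeOfNeronUnit`
# (stmt-BirchSwinnertonDyer-27892) — PROVED BY NAME (the planner's `Sketch20-LINE20-neron-unit.lean` argument)

Cell `pub/bsd-wall`, D-0145 line `route-BirchSwinnertonDyer-TeichmullerTwistDescent`, seat `bsd-line-ttd-p1` g9,
working the planner-of-record's TQMP LINE 20. BSD is NOT proved by this; Manin's conjecture is not proved by this;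
U19 (`TprimeRedOptimalIsogenyNeronUnit`, stmt-27879), F19 (`TprimeRedNeronUnitForcesKodairaThree`, stmt-27880) and
E19 (`TprimeRedOptimalIsKodairaThree`, stmt-27752) stay OPEN. This file closes ONLY the glue, which makes E19 a glued
node: E19 ⟸ U19 ∧ F19.

## Statement (verbatim the route decl)

`TprimeRedOptimalIsogenyNeronUnit → TprimeRedNeronUnitForcesKodairaThree → TprimeRedOptimalIsKodairaThree`.

## Proof

F19's last hypothesis (every index-`3` Néron sublattice relation out of the optimal `W` has `3 ∤ α`) is U19's
conclusion on the same binders. Pure logic. Design: theorems only; no definition, no named fact, no `sorry`; axioms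
`propext`, `Classical.choice`, `Quot.sound`.
-/

set_option autoImplicit false
-- D-0017: single-problem summit, so `Summit.BirchSwinnertonDyer.BirchSwinnertonDyer.…` repeats a namespace BY DESIGN.
set_option linter.dupNamespace false

namespace Summit.BirchSwinnertonDyer.BirchSwinnertonDyer.Theorems.TameQuarticManinParity

open Summit.BirchSwinnertonDyer.BirchSwinnertonDyer.Theses.TameQuarticManinParity

/-- **Glue G20** (stmt-BirchSwinnertonDyer-27892), by name: U19 (every `3`-isogeny out of the optimal curve of a
reducible (t′) class is étale on Néron differentials) → F19 (that forces Kodaira type III) → E19 (the optimal curve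
is the Kodaira-III end) — the planner's `Sketch20.tprimeRedKodairaThreeOfNeronUnit_proof`. -/
theorem tprimeRedKodairaThreeOfNeronUnit_proof : TprimeRedKodairaThreeOfNeronUnit := by
  unfold TprimeRedKodairaThreeOfNeronUnit
  intro hU hF W _ _ _ hcm hadd ht hred D hopt hdeg
  exact hF W hcm hadd ht hred D hopt hdeg
    (fun W₂ _ _ L₂ α hL hsub hidx ↦ hU W hcm hadd ht hred D hopt hdeg W₂ L₂ α hL hsub hidx)

end Summit.BirchSwinnertonDyer.BirchSwinnertonDyer.Theorems.TameQuarticManinParity
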